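import Summits.Ventures.PercRepro.MSTightBadExtensionPartner
import Summits.Ventures.PercRepro.ExcessOneSingleton
import Summits.Ventures.PercRepro.MSTightProjectionL3

/-!
# The extension lemma (Theorem (E) of Addendum 53): the induction

`K` a family with `|K \\ K| = |K| + 1`, twin-free on its support (two elements that both lie in
some member and both miss some member and are twins are equal), `t ∉ K` a set containing the core
of `K` (every element common to all members lies in `t`) with `t \ k ∈ K \\ K` for every member
and `t` below no member. Then `k \ t ∈ K \\ K` for every member `k`
(`sdiff_mem_diffs_of_bad_aux`), so `insert t K` is tight (`tight_insert_of_bad`); for an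
arbitrary bad `t` the set `t ∪ ∩K` is the extension (`tight_insert_union_core_of_bad`).

The proof is a strong induction on a support `u ⊇ ∪K` along an element `e ∈ ∪K ∖ t`: `e` is a
non-tightening direction (a tightening direction lies in `t`, `MSTightProjectionL3`), so Theorem
(NT) (`ExcessOneNonTightening`) describes the partner family `K'`, the induction hypothesis makes
`proj e K ∪ {t}` tight, MaxErase (`MSTightBadExtension`) puts `t.erase g` into the projection,
and the twin-closure of the flip of `K'` (Theorem S) gives `t ∩ Rstar K' ∈ K'` and then
`k₁ \ t ∈ K' \\ K'` for every `k₁ ∈ partr e K`.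
-/

namespace PercRepro.MSTight

open Finset
open scoped FinsetFamily symmDiff

variable {α : Type*} [DecidableEq α] [Fintype α]

/-- **Theorem (E), the induction.** -/
theorem sdiff_mem_diffs_of_bad_aux (u : Finset α) :
    ∀ (K : Finset (Finset α)) (t : Finset α), (∀ k ∈ K, k ⊆ u) →
      (K \\ K).card = K.card + 1 →
      (∀ a b, (∃ k ∈ K, a ∈ k) → (∃ k ∈ K, a ∉ k) → (∃ k ∈ K, b ∈ k) → (∃ k ∈ K, b ∉ k) →
        Twin K a b → a = b) →
      (∀ a, (∀ k ∈ K, a ∈ k) → a ∈ t) →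
      t ∉ K → (∀ k ∈ K, t \ k ∈ K \\ K) → (∀ k ∈ K, ¬ t ⊆ k) →
      ∀ k ∈ K, k \ t ∈ K \\ K := by
  induction u using Finset.strongInduction with
  | H u ih =>
  intro K t hKu hK htf hcore htK ht hnot
  have hne : K.Nonempty := by
    rw [nonempty_iff_ne_empty]
    rintro rfl
    simp at hK
  -- the trivial case: every element of some member lies in `t`
  by_cases htriv : ∀ e ∈ u, (∃ k ∈ K, e ∈ k) → e ∈ t
  · intro k hk
    have : k \ t = ∅ := by
      rw [sdiff_eq_empty_iff_subset]
      intro x hx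
      exact htriv x (hKu k hk hx) ⟨k, hk, hx⟩
    rw [this]
    obtain ⟨k₀, hk₀⟩ := hne
    exact mem_diffs.2 ⟨k₀, hk₀, k₀, hk₀, Finset.sdiff_self k₀⟩
  push Not at htriv
  obtain ⟨e, heu, ⟨ke, hke, heke⟩, het⟩ := htriv
  -- `e` is outside the core
  have heout : ∃ k ∈ K, e ∉ k := by
    by_contra h
    push Not at h
    exact het (hcore e h)
  -- the counts at `e`
  have hcount1 := card_diffs_eq_card_diffs_proj_add e K
  have hcount2 := card_eq_card_proj_add_card_partner e K
  have hQms : (proj e K).card ≤ (proj e K \\ proj e K).card := card_le_card_diffs _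
  have hK'ms : (partner e K).card ≤ (partner e K \\ partner e K).card := card_le_card_diffs _
  have hXY := card_le_card (diffs_partner_subset e K)
  -- notation
  set Q := proj e K with hQ
  set K' := partner e K with hK'
  -- ## Step 1: `e` is a non-tightening direction; Theorem (NT)
  have hQnt : ¬ Tight Q := fun h => het (mem_of_not_subset_of_tight_proj hne h ht hnot)
  have hQexc : (Q \\ Q).card = Q.card + 1 := by
    unfold Tight at hQnt
    omega
  have hε : (diffsX e K ∩ diffsY e K).card = K'.card := by omega
  -- (SD): `{e}` is a difference, so the partner family is nonempty
  have htwe : ∀ b, Twin K e b → b = e := by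
    intro b hb
    have hbin : ∃ k ∈ K, b ∈ k := ⟨ke, hke, (hb ke hke).1 heke⟩
    have hbout : ∃ k ∈ K, b ∉ k := by
      obtain ⟨k, hk, hek⟩ := heout
      exact ⟨k, hk, fun h => hek ((hb k hk).2 h)⟩
    exact (htf e b ⟨ke, hke, heke⟩ heout hbin hbout hb).symm
  have hsing : ({e} : Finset α) ∈ K \\ K :=
    singleton_mem_diffs_of_card_diffs_le (by omega) htwe ⟨ke, hke, heke⟩ heout
  have hK'ne : K'.Nonempty := by
    rw [nonempty_iff_ne_empty]
    intro h0
    have h1 : (∅ : Finset α) ∈ diffsX e K ∩ diffsY e K := by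
      refine mem_inter.2 ⟨mem_diffsX_iff.2 ⟨?_, notMem_empty e⟩, mem_diffsY_iff.2 ⟨notMem_empty e, ?_⟩⟩
      · exact mem_diffs.2 ⟨ke, hke, ke, hke, Finset.sdiff_self ke⟩
      · simpa using hsing
    have h2 := card_pos.2 ⟨∅, h1⟩
    rw [hε, h0] at h2
    simp at h2
  have hK'tight : Tight K' := (tight_partner_of_card_eq hε).1
  have hYeq : diffsY e K = K' \\ K' := diffsY_eq_diffs_partner_of_nonTightening hε hK'ne
  set R := Rstar K' with hR
  have hRK' : R ∈ K' := Rstar_partner_mem hε hK'ne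
  have hflip : K' \\ K' = flip R K' := diffs_eq_flip_of_tight hK'tight
  have hdich := dichotomy_of_tight hK'tight
  have hK'sub : K' ⊆ K := fun k hk => mem_of_mem_partner hk
  have hK'part0 : K' ⊆ part0 e K := fun k hk => (mem_inter.1 hk).1
  have hRK : R ∈ K := hK'sub hRK'
  have hmem2a : ∀ s ∈ part0 e K, s ∩ R ∈ K' := fun s hs => inter_Rstar_mem_partner hε hK'ne hs
  have hmem2b : ∀ s ∈ partr e K, s ∪ R ∈ K' := fun s hs => union_Rstar_mem_partner hε hK'ne hs
  -- ## Step 2: the induction hypothesis on `Q`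
  have hQu : ∀ q ∈ Q, q ⊆ u.erase e := by
    intro q hq
    obtain ⟨k, hk, rfl⟩ := mem_proj.1 hq
    intro x hx
    rw [mem_erase] at hx ⊢
    exact ⟨hx.1, hKu k hk hx.2⟩
  have hQtf : ∀ a b, (∃ q ∈ Q, a ∈ q) → (∃ q ∈ Q, a ∉ q) → (∃ q ∈ Q, b ∈ q) →
      (∃ q ∈ Q, b ∉ q) → Twin Q a b → a = b := by
    intro a b ⟨qa, hqa, haq⟩ ⟨qa', hqa', haq'⟩ ⟨qb, hqb, hbq⟩ ⟨qb', hqb', hbq'⟩ hab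
    obtain ⟨ka, hka, rfl⟩ := mem_proj.1 hqa
    obtain ⟨ka', hka', rfl⟩ := mem_proj.1 hqa'
    obtain ⟨kb, hkb, rfl⟩ := mem_proj.1 hqb
    obtain ⟨kb', hkb', rfl⟩ := mem_proj.1 hqb'
    have hae : a ≠ e := (mem_erase.1 haq).1
    have hbe : b ≠ e := (mem_erase.1 hbq).1
    refine htf a b ⟨ka, hka, (mem_erase.1 haq).2⟩ ⟨ka', hka', fun h => haq' (mem_erase.2 ⟨hae, h⟩)⟩
      ⟨kb, hkb, (mem_erase.1 hbq).2⟩ ⟨kb', hkb', fun h => hbq' (mem_erase.2 ⟨hbe, h⟩)⟩ ?_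
    intro k hk
    have := hab (k.erase e) (mem_proj.2 ⟨k, hk, rfl⟩)
    simp only [mem_erase, hae, hbe, true_and, ne_eq, not_false_eq_true] at this
    exact this
  have hQcore : ∀ a, (∀ q ∈ Q, a ∈ q) → a ∈ t := by
    intro a ha
    refine hcore a fun k hk => ?_
    exact mem_of_mem_erase (ha (k.erase e) (mem_proj.2 ⟨k, hk, rfl⟩))
  have htQ : t ∉ Q := by
    intro h
    obtain ⟨k, hk, hkt⟩ := mem_proj.1 h
    exact hnot k hk (hkt ▸ erase_subset e k)
  have htQ' : ∀ q ∈ Q, t \ q ∈ Q \\ Q := by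
    intro q hq
    obtain ⟨k, hk, rfl⟩ := mem_proj.1 hq
    have e1 : t \ k.erase e = t \ k := by
      ext x
      simp only [mem_sdiff, mem_erase, not_and]
      constructor
      · rintro ⟨hxt, hx⟩
        exact ⟨hxt, fun hxk => hx (fun hxe => het (hxe ▸ hxt)) hxk⟩
      · rintro ⟨hxt, hxk⟩
        exact ⟨hxt, fun _ => hxk⟩
    rw [e1, diffs_proj_eq]
    refine mem_union.2 (Or.inl (mem_diffsX_iff.2 ⟨ht k hk, ?_⟩))
    intro hx
    exact het (mem_sdiff.1 hx).1
  have hnotQ : ∀ q ∈ Q, ¬ t ⊆ q := by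
    intro q hq hsub
    obtain ⟨k, hk, rfl⟩ := mem_proj.1 hq
    exact hnot k hk (hsub.trans (erase_subset e k))
  have hIH : ∀ q ∈ Q, q \ t ∈ Q \\ Q :=
    ih (u.erase e) (erase_ssubset heu) Q t hQu hQexc hQtf hQcore htQ htQ' hnotQ
  -- ## Step 3: `T_Q = insert t Q` is tight and `t.erase g ∈ Q` for `g ∈ t` outside the core
  have hTQ : Tight (insert t Q) := tight_insert_of_sdiff_subset hQexc htQ htQ' hIH
  have htsubK : ∀ x ∈ t, ∃ k ∈ K, x ∈ k := by
    intro x hx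
    obtain ⟨k, hk⟩ := hne
    by_cases hxk : x ∈ k
    · exact ⟨k, hk, hxk⟩
    · have := ht k hk
      obtain ⟨a, ha, b, -, hab⟩ := mem_diffs.1 this
      have : x ∈ a \ b := hab ▸ mem_sdiff.2 ⟨hx, hxk⟩
      exact ⟨a, ha, (mem_sdiff.1 this).1⟩
  have htwQ : ∀ a b, a ∈ t → (∃ k ∈ K, a ∉ k) → Twin (insert t Q) a b → b = a := by
    intro a b hat ⟨ka, hka, haka⟩ hab
    have hae : a ≠ e := fun h => het (h ▸ hat)
    have hbt : b ∈ t := (hab t (mem_insert_self t Q)).1 hat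
    have hbe : b ≠ e := fun h => het (h ▸ hbt)
    obtain ⟨kb, hkb, hbkb⟩ := htsubK b hbt
    obtain ⟨ka', hka', haka'⟩ := htsubK a hat
    have hbout : ∃ k ∈ K, b ∉ k := by
      refine ⟨ka, hka, fun h => haka ?_⟩
      have h1 := hab (ka.erase e) (mem_insert_of_mem (mem_proj.2 ⟨ka, hka, rfl⟩))
      have h2 : a ∈ ka.erase e := h1.2 (mem_erase.2 ⟨hbe, h⟩)
      exact (mem_erase.1 h2).2
    refine (htf a b ⟨ka', hka', haka'⟩ ⟨ka, hka, haka⟩ ⟨kb, hkb, hbkb⟩ hbout ?_).symm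
    intro k hk
    have := hab (k.erase e) (mem_insert_of_mem (mem_proj.2 ⟨k, hk, rfl⟩))
    simp only [mem_erase, hae, hbe, true_and, ne_eq, not_false_eq_true] at this
    exact this
  have hcls : ∀ g ∈ t, (∃ k ∈ K, g ∉ k) → cls (insert t Q) g = {g} := by
    intro g hgt hgout
    ext b
    rw [mem_cls, mem_singleton]
    exact ⟨fun h => htwQ g b hgt hgout h, fun h => h ▸ twin_refl _ _⟩
  have hmax : ∀ A ∈ insert t Q, t ⊆ A → A = t := by
    intro A hA hsub
    rcases mem_insert.1 hA with rfl | hA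
    · rfl
    · exact absurd hsub (hnotQ A hA)
  have herase : ∀ g ∈ t, (∃ k ∈ K, g ∉ k) → t.erase g ∈ Q := by
    intro g hgt hgout
    have hc := hcls g hgt hgout
    obtain ⟨k, hk, hgk⟩ := hgout
    have h1 : t.erase g ∈ insert t Q :=
      erase_mem_of_tight_of_maximal hTQ (mem_insert_self t Q) hmax hgt hc
        ⟨k.erase e, mem_insert_of_mem (mem_proj.2 ⟨k, hk, rfl⟩), fun h => hgk (mem_of_mem_erase h)⟩
    rcases mem_insert.1 h1 with h | h
    · exfalso
      have h2 : g ∉ t.erase g := notMem_erase g t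
      rw [h] at h2
      exact h2 hgt
    · exact h
  -- ## Steps 4 and 5 (MSTightBadExtensionPartner)
  have hstep4 := inter_Rstar_mem_partner_of_bad hε hK'ne het hcore ht hnot hTQ htwQ herase
  have hqK' : t ∩ R ∈ K' := hstep4.1
  have hRg : ∃ g ∈ t, R.erase g ∈ K' := by
    obtain ⟨g, hgq, hgout⟩ := exists_mem_inter_notMem_core_of_bad ht hnot hRK
    exact ⟨g, (mem_inter.1 hgq).1, hstep4.2 g hgq hgout⟩
  have hstep5 : ∀ k₁ ∈ partr e K, k₁ \ t ∈ diffsY e K :=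
    sdiff_mem_diffsY_of_bad hε hK'ne htf hcore hqK' hRg
  -- ## Step 6: assemble
  intro k hk
  by_cases hek : e ∈ k
  · have hk₁ : k.erase e ∈ partr e K := mem_partr.2 ⟨notMem_erase e k, by rwa [insert_erase hek]⟩
    have h5 := hstep5 _ hk₁
    rw [mem_diffsY_iff] at h5
    have e1 : insert e (k.erase e \ t) = k \ t := by
      ext x
      simp only [mem_insert, mem_sdiff, mem_erase]
      constructor
      · rintro (rfl | ⟨⟨_, hx⟩, hxt⟩)
        · exact ⟨hek, het⟩
        · exact ⟨hx, hxt⟩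
      · rintro ⟨hxk, hxt⟩
        by_cases hxe : x = e
        · exact Or.inl hxe
        · exact Or.inr ⟨⟨hxe, hxk⟩, hxt⟩
    rw [← e1]
    exact h5.2
  · have hkQ : k ∈ Q := mem_proj.2 ⟨k, hk, erase_eq_of_notMem hek⟩
    have h6 := hIH k hkQ
    rw [diffs_proj_eq] at h6
    rcases mem_union.1 h6 with h | h
    · exact (mem_diffsX_iff.1 h).1
    · rw [hYeq] at h
      exact diffs_subset hK'sub hK'sub h

/-- **Theorem (E), core inside `t`.** -/
theorem sdiff_mem_diffs_of_bad {K : Finset (Finset α)} {t : Finset α}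
    (hK : (K \\ K).card = K.card + 1)
    (htf : ∀ a b, (∃ k ∈ K, a ∈ k) → (∃ k ∈ K, a ∉ k) → (∃ k ∈ K, b ∈ k) → (∃ k ∈ K, b ∉ k) →
      Twin K a b → a = b)
    (hcore : ∀ a, (∀ k ∈ K, a ∈ k) → a ∈ t) (htK : t ∉ K) (ht : ∀ k ∈ K, t \ k ∈ K \\ K)
    (hnot : ∀ k ∈ K, ¬ t ⊆ k) : ∀ k ∈ K, k \ t ∈ K \\ K :=
  sdiff_mem_diffs_of_bad_aux univ K t (fun _ _ => subset_univ _) hK htf hcore htK ht hnot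

/-- **Theorem (E), tightness form.** A bad set containing the core extends an excess-one family
to a tight family. -/
theorem tight_insert_of_bad {K : Finset (Finset α)} {t : Finset α}
    (hK : (K \\ K).card = K.card + 1)
    (htf : ∀ a b, (∃ k ∈ K, a ∈ k) → (∃ k ∈ K, a ∉ k) → (∃ k ∈ K, b ∈ k) → (∃ k ∈ K, b ∉ k) →
      Twin K a b → a = b)
    (hcore : ∀ a, (∀ k ∈ K, a ∈ k) → a ∈ t) (htK : t ∉ K) (ht : ∀ k ∈ K, t \ k ∈ K \\ K)
    (hnot : ∀ k ∈ K, ¬ t ⊆ k) : Tight (insert t K) :=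
  tight_insert_of_sdiff_subset hK htK ht (sdiff_mem_diffs_of_bad hK htf hcore htK ht hnot)

/-- **Theorem (E).** For an excess-one family `K` (twin-free on its support) with core `c`, and a
bad set `t` (`t \ k ∈ K \\ K` for all `k`, `t` below no member — so `t ∉ K`), `t ∪ c` is a
tight one-point extension: `insert (t ∪ c) K` is tight. -/
theorem tight_insert_union_core_of_bad {K : Finset (Finset α)} {t c : Finset α}
    (hc : ∀ a, a ∈ c ↔ ∀ k ∈ K, a ∈ k) (hK : (K \\ K).card = K.card + 1)
    (htf : ∀ a b, (∃ k ∈ K, a ∈ k) → (∃ k ∈ K, a ∉ k) → (∃ k ∈ K, b ∈ k) → (∃ k ∈ K, b ∉ k) →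
      Twin K a b → a = b)
    (ht : ∀ k ∈ K, t \ k ∈ K \\ K) (hnot : ∀ k ∈ K, ¬ t ⊆ k) :
    Tight (insert (t ∪ c) K) := by
  have hck : ∀ k ∈ K, c ⊆ k := fun k hk x hx => (hc x).1 hx k hk
  refine tight_insert_of_bad hK htf ?_ ?_ ?_ ?_
  · intro a ha
    exact mem_union_right _ ((hc a).2 ha)
  · intro h
    exact hnot _ h subset_union_left
  · intro k hk
    have : (t ∪ c) \ k = t \ k := by
      ext x
      simp only [mem_sdiff, mem_union]
      constructor
      · rintro ⟨hx | hx, hxk⟩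
        · exact ⟨hx, hxk⟩
        · exact absurd (hck k hk hx) hxk
      · rintro ⟨hx, hxk⟩
        exact ⟨Or.inl hx, hxk⟩
    rw [this]
    exact ht k hk
  · intro k hk h
    exact hnot k hk (subset_union_left.trans h)

end PercRepro.MSTight
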